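import Summits.FinalStateConjecture.FinalStateConjecture.Theorems.EIHFluxBalanceInertialRecessionStubMomCapstoneJetAffine

/-!
# Route EIHFluxBalance — `InertialRecession` (E′), line `SketchCleanExcision`, skeleton r13,
# stub `stub_momCapstone` (A): the SLICE-LIPSCHITZ estimate for the momentum rows on jet space

Helper file for the crux `stmt-FinalStateConjecture-17403`
(`Summit.FinalStateConjecture.FinalStateConjecture.Theses.EIHFluxBalance.InertialRecession`, E′),
registered stub `stub_momCapstone` (A) of skeleton r13; continuation of
`…StubMomCapstoneJetAffine`. The momentum rows `Ψ(J) = ricciJet J (B⁻¹ n) e` (`n(e) = 0`) of a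
jet `J = (0, B, D₁, D₂)` perturbed along `n` by normal data `(A, P, W)` are, by the first half of
the registered momentum-row lemma `stub_momRowLinear` (ML(i), a HYPOTHESIS here), additive and
homogeneous in `(A, P)` and blind to `W`. Consequently the dependence of the perturbed rows on the
SLICE part of the jet is Lipschitz with a constant that grows only LINEARLY in the size of the
normal data:

* `momCap_contDiffOn_rowsJet` — `(J, (A, P), e) ↦ Ψ(J + ι(A, P, 0))` is `C¹` on `{B invertible}`;
* `momCap_jet_sliceLipschitz` — **for `J` in a compact set of jets and `J'` within `r` of `J`:
  `|Ψ(J' + ι(A,P,W)) − Ψ(J + ι(A,P,W))| ≤ (1 + 2s) L ‖J' − J‖` whenever `‖A‖, ‖P‖ ≤ s`** — write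
  `Ψ(J + ι(A,P,W)) = Ψ(J) + s(Ψ(J + ι(Â,P̂,0)) − Ψ(J))` with UNIT data `(Â, P̂) = s⁻¹(A, P)`
  (homogeneity, `momCap_jetML₁_hom`) and use the uniform Lipschitz bound of the `C¹` function above
  near the compact set `K × B̄(0,1) × B̄(0,1)` (`exists_uniform_lipschitz_near_isCompact`).

This is the jet-space form of "the momentum constraint is affine in the normal derivatives": it is
what makes the momentum-row estimate of `stub_momCapstone` linear (not quadratic) in the first jet
of the painted motion. No definitions, no named facts, no `sorry`.
-/

set_option linter.dupNamespace false
set_option maxSynthPendingDepth 6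
set_option synthInstance.maxHeartbeats 200000

noncomputable section

namespace Summit.FinalStateConjecture.FinalStateConjecture.Theorems.SublinearIsFree.Slaving

open scoped BigOperators Topology ContDiff
open Filter Set Function Metric Literature.Geometry.Lorentzian
  Literature.Geometry.Lorentzian.MetricCoord
open Summit.FinalStateConjecture.FinalStateConjecture.Theorems

/-! ### The slice-Lipschitz estimate for the momentum rows on jet space -/

/-- The space of `2`-jets of metric components on `E4` (local notation). -/
local notation "Jet" => E4 × (E4 →L[ℝ] E4 →L[ℝ] ℝ) × (E4 →L[ℝ] E4 →L[ℝ] E4 →L[ℝ] ℝ) ×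
  (E4 →L[ℝ] E4 →L[ℝ] E4 →L[ℝ] E4 →L[ℝ] ℝ)

/-- The space of normal data `(A, P)` of a jet along a covector (local notation). -/
local notation "Nrm" => (E4 →L[ℝ] E4 →L[ℝ] ℝ) × (E4 →L[ℝ] E4 →L[ℝ] E4 →L[ℝ] ℝ)

set_option maxHeartbeats 1600000 in
/-- **The rows with normal data `(A, P)` inserted are a `C¹` function of (jet, normal data,
vector).** `(J, (A, P), e) ↦ ricciJet (J.1, B, D₁ + n ⊗ A, D₂ + (n ⊗ P + (n ⊗ P)ᵗ)) (B⁻¹ n) e`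
(`J = (J.1, B, D₁, D₂)`) is `C¹` on `{B invertible}` (`contDiffOn_ricciJet`, smoothness of
inversion, the insertion being affine). [folklore] -/
theorem momCap_contDiffOn_rowsJet (n : E4 →L[ℝ] ℝ) : ContDiffOn ℝ 1 (fun q : Jet × Nrm × E4 ↦
    ricciJet ((q.1.1, q.1.2.1, q.1.2.2.1 + n.smulRight q.2.1.1,
      q.1.2.2.2 + (n.smulRight q.2.1.2 + (n.smulRight q.2.1.2).flip)) : Jet) ((q.1.2.1).inverse n) q.2.2)
    {q | q.1.2.1.IsInvertible} := by
  have hsm₁ : ContDiff ℝ ∞ (fun A : E4 →L[ℝ] E4 →L[ℝ] ℝ ↦ n.smulRight A) := by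
    have : (fun A : E4 →L[ℝ] E4 →L[ℝ] ℝ ↦ n.smulRight A) =
        fun A ↦ ContinuousLinearMap.smulRightL ℝ E4 (E4 →L[ℝ] E4 →L[ℝ] ℝ) n A := by
      funext A; rfl
    rw [this]
    exact (ContinuousLinearMap.smulRightL ℝ E4 (E4 →L[ℝ] E4 →L[ℝ] ℝ) n).contDiff
  have hsm₂ : ContDiff ℝ ∞ (fun P : E4 →L[ℝ] E4 →L[ℝ] E4 →L[ℝ] ℝ ↦
      n.smulRight P + (n.smulRight P).flip) := by
    have h1 : ContDiff ℝ ∞ (fun P : E4 →L[ℝ] E4 →L[ℝ] E4 →L[ℝ] ℝ ↦ n.smulRight P) := by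
      have : (fun P : E4 →L[ℝ] E4 →L[ℝ] E4 →L[ℝ] ℝ ↦ n.smulRight P) =
          fun P ↦ ContinuousLinearMap.smulRightL ℝ E4 (E4 →L[ℝ] E4 →L[ℝ] E4 →L[ℝ] ℝ) n P := by
        funext P; rfl
      rw [this]
      exact (ContinuousLinearMap.smulRightL ℝ E4 (E4 →L[ℝ] E4 →L[ℝ] E4 →L[ℝ] ℝ) n).contDiff
    exact h1.add ((ContinuousLinearMap.flipₗᵢ ℝ E4 E4 (E4 →L[ℝ] E4 →L[ℝ] ℝ)).contDiff.comp h1)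
  have hJ : ContDiff ℝ ∞ (fun q : Jet × Nrm × E4 ↦ ((q.1.1, q.1.2.1, q.1.2.2.1 + n.smulRight q.2.1.1,
      q.1.2.2.2 + (n.smulRight q.2.1.2 + (n.smulRight q.2.1.2).flip)) : Jet)) := by
    refine contDiff_fst.fst.prodMk (contDiff_fst.snd.fst.prodMk (ContDiff.prodMk ?_ ?_))
    · exact contDiff_fst.snd.snd.fst.add (hsm₁.comp contDiff_snd.fst.fst)
    · exact contDiff_fst.snd.snd.snd.add (hsm₂.comp contDiff_snd.fst.snd)
  intro q hq
  have hq' : ((q.1.1, q.1.2.1, q.1.2.2.1 + n.smulRight q.2.1.1,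
      q.1.2.2.2 + (n.smulRight q.2.1.2 + (n.smulRight q.2.1.2).flip)) : Jet) ∈
      {j : Jet | j.2.1.IsInvertible} := hq
  have hR : ContDiffAt ℝ ∞ (fun q : Jet × Nrm × E4 ↦ ricciJet ((q.1.1, q.1.2.1,
      q.1.2.2.1 + n.smulRight q.2.1.1,
      q.1.2.2.2 + (n.smulRight q.2.1.2 + (n.smulRight q.2.1.2).flip)) : Jet)) q :=
    ContDiffAt.comp (g := ricciJet (E := E4)) (f := fun q : Jet × Nrm × E4 ↦ ((q.1.1, q.1.2.1,
      q.1.2.2.1 + n.smulRight q.2.1.1,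
      q.1.2.2.2 + (n.smulRight q.2.1.2 + (n.smulRight q.2.1.2).flip)) : Jet)) q
      (contDiffOn_ricciJet.contDiffAt (isOpen_ricciJetDomain.mem_nhds hq')) hJ.contDiffAt
  have hI : ContDiffAt ℝ ∞ (fun q : Jet × Nrm × E4 ↦ (q.1.2.1).inverse) q :=
    (ContinuousLinearMap.IsInvertible.contDiffAt_map_inverse hq).comp q contDiffAt_fst.snd.fst
  have hΘ : ContDiffAt ℝ ∞ (fun q : Jet × Nrm × E4 ↦
      ricciJet ((q.1.1, q.1.2.1, q.1.2.2.1 + n.smulRight q.2.1.1,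
        q.1.2.2.2 + (n.smulRight q.2.1.2 + (n.smulRight q.2.1.2).flip)) : Jet) ((q.1.2.1).inverse n) q.2.2) q :=
    (hR.clm_apply (hI.clm_apply contDiffAt_const)).clm_apply contDiffAt_snd.snd
  exact (hΘ.of_le (by simp)).contDiffWithinAt

/-- The elementary inequality behind the slice-Lipschitz estimate: if `T − t₀ = s(t₁ − t₀)`,
`T' − t₀' = s(t₁' − t₀')`, `|t₀' − t₀| ≤ Ld` and `|t₁' − t₁| ≤ Ld` with `s, Ld ≥ 0`, then
`|T' − T| ≤ (1 + 2s) L d`. [folklore] -/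
theorem momCap_abs_affine_combo {T T' t₀ t₀' t₁ t₁' s L d : ℝ} (hs : 0 ≤ s)
    (hom : T - t₀ = s * (t₁ - t₀)) (hom' : T' - t₀' = s * (t₁' - t₀')) (h₀ : |t₀' - t₀| ≤ L * d)
    (h₁ : |t₁' - t₁| ≤ L * d) (_hLd : 0 ≤ L * d) : |T' - T| ≤ (1 + 2 * s) * L * d := by
  have e1 : T' - T = (1 - s) * (t₀' - t₀) + s * (t₁' - t₁) := by linear_combination hom' - hom
  rw [e1]
  calc |(1 - s) * (t₀' - t₀) + s * (t₁' - t₁)|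
      ≤ |1 - s| * |t₀' - t₀| + |s| * |t₁' - t₁| := by
        simpa only [abs_mul] using abs_add_le ((1 - s) * (t₀' - t₀)) (s * (t₁' - t₁))
    _ ≤ (1 + s) * (L * d) + s * (L * d) := by
        gcongr
        · exact (abs_sub _ _).trans (by rw [abs_one, abs_of_nonneg hs])
        · exact (abs_of_nonneg hs).le
    _ = (1 + 2 * s) * L * d := by ring

/-- Normalising a vector of norm `≤ s` by `s⁻¹` gives norm `≤ 1`, and `s • s⁻¹ • X = X` (also when
`s = 0`, where `X = 0`). [folklore] -/
theorem momCap_unit_smul {F : Type*} [NormedAddCommGroup F] [NormedSpace ℝ F] {X : F} {s : ℝ}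
    (hX : ‖X‖ ≤ s) : ‖s⁻¹ • X‖ ≤ 1 ∧ s • s⁻¹ • X = X := by
  have hs0 : 0 ≤ s := (norm_nonneg X).trans hX
  by_cases hs : s = 0
  · have hX0 : X = 0 := norm_le_zero_iff.1 (by simpa [hs] using hX)
    simp [hs, hX0]
  · have hs' : 0 < s := lt_of_le_of_ne hs0 (Ne.symm hs)
    refine ⟨?_, by rw [smul_smul, mul_inv_cancel₀ hs, one_smul]⟩
    rw [norm_smul, norm_inv, Real.norm_eq_abs, abs_of_pos hs']
    exact (inv_mul_le_iff₀ hs').2 (by simpa using hX)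

set_option maxHeartbeats 1600000 in
/-- **Slice-Lipschitz estimate for the momentum rows on jet space.** Let the mixed rows be
additive and homogeneous in the normal data (ML(i), hypothesis `hML₁`), `K` a compact set of jets
with invertible values and `n` a covector. There are `r > 0`, `L ≥ 0` such that for every symmetric
jet `J = (0, B, D₁, D₂) ∈ K`, every symmetric jet `J' = (0, B', D₁', D₂')` with invertible value and
`‖J' − J‖ ≤ r`, every symmetric normal datum `(A, P, W)` with `‖A‖, ‖P‖ ≤ s`, and `‖e‖ ≤ 1`,
`n(e) = 0`: `|Ψ(J' + ι(A,P,W)) − Ψ(J + ι(A,P,W))| ≤ (1 + 2s) L ‖J' − J‖` (`Ψ(J) = ricciJet J (B⁻¹n) e`).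
Proof: by homogeneity `Ψ(J + ι(A,P,W)) = Ψ(J) + s (Ψ(J + ι(Â,P̂,0)) − Ψ(J))` with unit data
`(Â, P̂) = s⁻¹(A, P)`, and the `C¹` function `(J, (Â,P̂), e) ↦ Ψ(J + ι(Â,P̂,0))` is uniformly
Lipschitz near the compact set `K × B̄(0,1) × B̄(0,1)` (`exists_uniform_lipschitz_near_isCompact`).
[folklore] -/
theorem momCap_jet_sliceLipschitz
    (hML₁ : ∀ {G G₁ G₂ G₃ : E4 → E4 →L[ℝ] E4 →L[ℝ] ℝ} {V : Set E4} {x : E4} {n : E4 →L[ℝ] ℝ} {A₁ A₂ : E4 →L[ℝ] E4 →L[ℝ] ℝ} {P₁ P₂ : E4 →L[ℝ] E4 →L[ℝ] E4 →L[ℝ] ℝ} {W₁ W₂ W₃ : E4 →L[ℝ] E4 →L[ℝ] ℝ} (c₁ c₂ : ℝ), MetricCoord.IsMetricOn G V → MetricCoord.IsMetricOn G₁ V → MetricCoord.IsMetricOn G₂ V → MetricCoord.IsMetricOn G₃ V → x ∈ V → G₁ x = G x → G₂ x = G x → G₃ x = G x → fderiv ℝ G₁ x = fderiv ℝ G x +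 n.smulRight A₁ → fderiv ℝ G₂ x = fderiv ℝ G x + n.smulRight A₂ → fderiv ℝ G₃ x = fderiv ℝ G x + n.smulRight (c₁ • A₁ + c₂ • A₂) → (∀ v, fderiv ℝ (fderiv ℝ G₁) x v = fderiv ℝ (fderiv ℝ G) x v + (n v • P₁ + n.smulRight (P₁ v) + n v • n.smulRight W₁)) → (∀ v, fderiv ℝ (fderiv ℝ G₂) x v = fderiv ℝ (fderiv ℝ G) x v + (n v • P₂ + n.smulRight (P₂ v) + n v • n.smulRight W₂)) → (∀ v, fderiv ℝ (fderiv ℝ G₃) x v = fderiv ℝ (fderiv ℝ G) x v + (n v • (c₁ • P₁ + c₂ • P₂) + n.smulRight ((c₁ • P₁ + c₂ • P₂) v) + n v • n.smulRight W₃)) → ∀ e : E4, n e = 0 → MetricCoord.ricAt G₃ x (MetricCoord.sharpAt G x n) e - MetricCoord.ricAt G x (MetricCoord.sharpAt G x n) e = c₁ * (MetricCoord.ricAt G₁ x (MetricCoord.sharpAt G x n) e - MetricCoord.ricAt G x (MetricCoord.sharpAt G x n) e) + c₂ * (MetricCoord.ricAt G₂ x (MetricCoord.sharpAt G x n) e -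 MetricCoord.ricAt G x (MetricCoord.sharpAt G x n) e))
    {K : Set Jet} (hKc : IsCompact K) (hKΩ : K ⊆ {j : Jet | j.2.1.IsInvertible}) (n : E4 →L[ℝ] ℝ) :
    ∃ r : ℝ, 0 < r ∧ ∃ L : ℝ, 0 ≤ L ∧
      ∀ {B B' : E4 →L[ℝ] E4 →L[ℝ] ℝ} {D₁ D₁' : E4 →L[ℝ] E4 →L[ℝ] E4 →L[ℝ] ℝ}
        {D₂ D₂' D₂J D₂J' : E4 →L[ℝ] E4 →L[ℝ] E4 →L[ℝ] E4 →L[ℝ] ℝ} {A : E4 →L[ℝ] E4 →L[ℝ] ℝ}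
        {P : E4 →L[ℝ] E4 →L[ℝ] E4 →L[ℝ] ℝ} {W : E4 →L[ℝ] E4 →L[ℝ] ℝ} {s : ℝ},
        (((0 : E4), B, D₁, D₂) : Jet) ∈ K → B'.IsInvertible →
        ‖(((0 : E4), B', D₁', D₂') : Jet) - ((0 : E4), B, D₁, D₂)‖ ≤ r →
        (∀ v w, B v w = B w v) → (∀ z v w, D₁ z v w = D₁ z w v) →
        (∀ z z' v w, D₂ z z' v w = D₂ z z' w v) → (∀ v w, D₂ v w = D₂ w v) →
        (∀ v w, B' v w = B' w v) → (∀ z v w, D₁' z v w = D₁' z w v) →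
        (∀ z z' v w, D₂' z z' v w = D₂' z z' w v) → (∀ v w, D₂' v w = D₂' w v) →
        (∀ v w, A v w = A w v) → (∀ z v w, P z v w = P z w v) → (∀ v w, W v w = W w v) →
        ‖A‖ ≤ s → ‖P‖ ≤ s →
        (∀ v, D₂J v = D₂ v + (n v • P + n.smulRight (P v) + n v • n.smulRight W)) →
        (∀ v, D₂J' v = D₂' v + (n v • P + n.smulRight (P v) + n v • n.smulRight W)) →
        ∀ e : E4, ‖e‖ ≤ 1 → n e = 0 →
        |ricciJet (((0 : E4), B', D₁' + n.smulRight A, D₂J') : Jet) (B'.inverse n) e -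
            ricciJet (((0 : E4), B, D₁ + n.smulRight A, D₂J) : Jet) (B.inverse n) e| ≤
          (1 + 2 * s) * L * ‖(((0 : E4), B', D₁', D₂') : Jet) - ((0 : E4), B, D₁, D₂)‖ := by
  -- the rows as a `C¹` function of (jet, unit normal data, vector), and its domain
  set Θ : Jet × Nrm × E4 → ℝ := fun q ↦
    ricciJet ((q.1.1, q.1.2.1, q.1.2.2.1 + n.smulRight q.2.1.1,
      q.1.2.2.2 + (n.smulRight q.2.1.2 + (n.smulRight q.2.1.2).flip)) : Jet) ((q.1.2.1).inverse n) q.2.2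
    with hΘ
  have hΩ' : IsOpen {q : Jet × Nrm × E4 | q.1.2.1.IsInvertible} :=
    (isOpen_ricciJetDomain (E := E4)).preimage continuous_fst
  have hΘd : ContDiffOn ℝ 1 Θ {q : Jet × Nrm × E4 | q.1.2.1.IsInvertible} :=
    momCap_contDiffOn_rowsJet n
  -- the compact set `K × B̄(0,1) × B̄(0,1)`
  haveI i1 : FiniteDimensional ℝ (E4 →L[ℝ] E4 →L[ℝ] ℝ) := inferInstance
  haveI i2 : FiniteDimensional ℝ (E4 →L[ℝ] E4 →L[ℝ] E4 →L[ℝ] ℝ) := inferInstance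
  haveI i3 : FiniteDimensional ℝ (E4 →L[ℝ] E4 →L[ℝ] E4 →L[ℝ] E4 →L[ℝ] ℝ) := inferInstance
  haveI i4 : FiniteDimensional ℝ Jet := inferInstance
  haveI i5 : FiniteDimensional ℝ Nrm := inferInstance
  haveI i6 : FiniteDimensional ℝ (Jet × Nrm × E4) := inferInstance
  haveI : ProperSpace Nrm := FiniteDimensional.proper_real _
  haveI : ProperSpace (Jet × Nrm × E4) := FiniteDimensional.proper_real _
  set K' : Set (Jet × Nrm × E4) := K ×ˢ (closedBall (0 : Nrm) 1 ×ˢ closedBall (0 : E4) 1) with hK'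
  have hK'c : IsCompact K' :=
    hKc.prod ((isCompact_closedBall _ _).prod (isCompact_closedBall _ _))
  have hK'Ω : K' ⊆ {q : Jet × Nrm × E4 | q.1.2.1.IsInvertible} := fun q hq ↦ hKΩ hq.1
  obtain ⟨r, hr, L, B₀, hL, -, hLip⟩ := exists_uniform_lipschitz_near_isCompact hΩ' hΘd hK'c hK'Ω
  refine ⟨r, hr, L, hL, fun {B B' D₁ D₁' D₂ D₂' D₂J D₂J' A P W s} hK hB'i hdist hB hD₁ hD₂ hD₂c
    hB' hD₁' hD₂' hD₂'c hA hP hW hAs hPs hD₂J hD₂J' e he1 he ↦ ?_⟩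
  have hBi : B.IsInvertible := hKΩ hK
  have hs0 : 0 ≤ s := (norm_nonneg A).trans hAs
  -- unit normal data
  set Au : E4 →L[ℝ] E4 →L[ℝ] ℝ := s⁻¹ • A with hAu
  set Pu : E4 →L[ℝ] E4 →L[ℝ] E4 →L[ℝ] ℝ := s⁻¹ • P with hPu
  obtain ⟨hAu1, hsA⟩ := momCap_unit_smul hAs
  obtain ⟨hPu1, hsP⟩ := momCap_unit_smul hPs
  have hAus : ∀ v w, Au v w = Au w v := fun v w ↦ by simp only [hAu, smul_apply, hA v w]
  have hPus : ∀ z v w, Pu z v w = Pu z w v := fun z v w ↦ by simp only [hPu, smul_apply, hP z v w]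
  have h0s : ∀ v w : E4, (0 : E4 →L[ℝ] E4 →L[ℝ] ℝ) v w = (0 : E4 →L[ℝ] E4 →L[ℝ] ℝ) w v :=
    fun v w ↦ rfl
  -- the second components perturbed by the unit data with `W = 0`
  set D₂u : E4 →L[ℝ] E4 →L[ℝ] E4 →L[ℝ] E4 →L[ℝ] ℝ := D₂ + (n.smulRight Pu + (n.smulRight Pu).flip)
    with hD₂u
  set D₂u' : E4 →L[ℝ] E4 →L[ℝ] E4 →L[ℝ] E4 →L[ℝ] ℝ := D₂' + (n.smulRight Pu + (n.smulRight Pu).flip)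
    with hD₂u'
  have hTu : ∀ (D : E4 →L[ℝ] E4 →L[ℝ] E4 →L[ℝ] E4 →L[ℝ] ℝ) (v : E4),
      (D + (n.smulRight Pu + (n.smulRight Pu).flip)) v =
        D v + (n v • Pu + n.smulRight (Pu v) + n v • n.smulRight (0 : E4 →L[ℝ] E4 →L[ℝ] ℝ)) := by
    intro D v
    ext w Y Z
    simp
  -- homogeneity at `J` and at `J'`
  have hom := momCap_jetML₁_hom hML₁ (D₂' := D₂u) (D₂'' := D₂J) (W := W) (W' := 0) s hB hBi hD₁
    hD₂ hD₂c hAus hPus hW h0s (fun v ↦ by rw [hD₂u, hTu]) (fun v ↦ by rw [hsP]; exact hD₂J v) e he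
  have hom' := momCap_jetML₁_hom hML₁ (D₂' := D₂u') (D₂'' := D₂J') (W := W) (W' := 0) s hB' hB'i
    hD₁' hD₂' hD₂'c hAus hPus hW h0s (fun v ↦ by rw [hD₂u', hTu]) (fun v ↦ by rw [hsP]; exact hD₂J' v)
    e he
  rw [hsA] at hom hom'
  -- the Lipschitz estimates for `Θ` between `(J', ·, e)` and `(J, ·, e)`
  have hmem₀ : ((((0 : E4), B, D₁, D₂) : Jet), ((0 : Nrm)), e) ∈ K' :=
    ⟨hK, mem_closedBall_zero_iff.2 (by simp), mem_closedBall_zero_iff.2 he1⟩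
  have hmem₁ : ((((0 : E4), B, D₁, D₂) : Jet), ((Au, Pu) : Nrm), e) ∈ K' :=
    ⟨hK, mem_closedBall_zero_iff.2 (by rw [Prod.norm_mk]; exact max_le hAu1 hPu1),
      mem_closedBall_zero_iff.2 he1⟩
  have hd : ∀ ν : Nrm, ‖((((0 : E4), B', D₁', D₂') : Jet), ν, e) -
      ((((0 : E4), B, D₁, D₂) : Jet), ν, e)‖ =
      ‖(((0 : E4), B', D₁', D₂') : Jet) - ((0 : E4), B, D₁, D₂)‖ := fun ν ↦ by
    simp [Prod.norm_def]
  have hL₀ := (hLip _ hmem₀ ((((0 : E4), B', D₁', D₂') : Jet), ((0 : Nrm)), e)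
    (by rw [hd]; exact hdist)).1
  have hL₁ := (hLip _ hmem₁ ((((0 : E4), B', D₁', D₂') : Jet), ((Au, Pu) : Nrm), e)
    (by rw [hd]; exact hdist)).1
  rw [hd, Real.norm_eq_abs] at hL₀ hL₁
  -- the values of `Θ`
  have hΘ0 : ∀ (B₀ : E4 →L[ℝ] E4 →L[ℝ] ℝ) (D : E4 →L[ℝ] E4 →L[ℝ] E4 →L[ℝ] ℝ)
      (DD : E4 →L[ℝ] E4 →L[ℝ] E4 →L[ℝ] E4 →L[ℝ] ℝ),
      Θ ((((0 : E4), B₀, D, DD) : Jet), ((0 : Nrm)), e) =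
        ricciJet (((0 : E4), B₀, D, DD) : Jet) (B₀.inverse n) e := by
    intro B₀ D DD
    simp [hΘ]
  have hΘ1 : ∀ (B₀ : E4 →L[ℝ] E4 →L[ℝ] ℝ) (D : E4 →L[ℝ] E4 →L[ℝ] E4 →L[ℝ] ℝ)
      (DD : E4 →L[ℝ] E4 →L[ℝ] E4 →L[ℝ] E4 →L[ℝ] ℝ),
      Θ ((((0 : E4), B₀, D, DD) : Jet), ((Au, Pu) : Nrm), e) =
        ricciJet (((0 : E4), B₀, D + n.smulRight Au, DD + (n.smulRight Pu + (n.smulRight Pu).flip)) : Jet)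
          (B₀.inverse n) e := by
    intro B₀ D DD
    simp only [hΘ]
  rw [hΘ0, hΘ0] at hL₀
  rw [hΘ1, hΘ1, ← hD₂u, ← hD₂u'] at hL₁
  -- assemble
  exact momCap_abs_affine_combo hs0 hom hom' hL₀ hL₁ (mul_nonneg hL (norm_nonneg _))

/-- **Registered one-line carrier form** (`momCap_abs_affine_combo_sA`) of
`momCap_abs_affine_combo`, the elementary inequality behind the slice-Lipschitz estimate. [folklore] -/
theorem momCap_abs_affine_combo_sA : ∀ {T T' t₀ t₀' t₁ t₁' s L d : ℝ}, 0 ≤ s → T - t₀ = s * (t₁ - t₀) → T' - t₀' = s * (t₁' - t₀') → |t₀' - t₀| ≤ L * d → |t₁' - t₁| ≤ L * d → 0 ≤ L * d → |T' - T| ≤ (1 + 2 * s) * L * d :=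
  fun hs hom hom' h₀ h₁ hLd ↦ momCap_abs_affine_combo hs hom hom' h₀ h₁ hLd

end Summit.FinalStateConjecture.FinalStateConjecture.Theorems.SublinearIsFree.Slaving

end
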